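import Literature.Computability.Complexity.GabberGalilRegion
import Literature.Computability.Complexity.ZigZag
import Literature.Computability.Complexity.LazyWalks
import HarnessLib

/-!
# The Margulis–Gabber–Galil expanders: an explicit spectral bound (Lee 2013, Thm. 2.3, discrete proof)

"For a number `n ≥ 2`, we define the graph `G_n = (V_n, E_n)` with vertex set `V_n = (ℤ/nℤ)²`.  A vertex
`(x, y)` is connected to the vertices `{(x, y ± 1), (x ± 1, y), (x, x ± y), (x ± y, y)}` … **Theorem 2.3.**
There is a constant `c > 0` such that for every `n ≥ 2`, `λ₂(G_n) ≥ c`" (J. R. Lee, *On expanders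
from the action of GL(2,ℤ)*, 2013).  Assembling `GabberGalilZ2` (the shears of `ℤ²` expand, co-area),
`GabberGalilFourier` (energy in Fourier space, passage to the modulus) and `GabberGalilRegion` (the
low-frequency window), this file obtains the theorem with an explicit constant, for every `n ≥ 1`, in
the tree's language of rotation graphs and `SpectralBound`:

* `graph m : RotGraph (m * m) 8` — the Gabber–Galil graph (labels `0..7`: `x±1`, `y±1`, `(x±y, y)`,
  `(x, y±x)`), an explicit involutive rotation map of closed form;
* `energyT_ge` — **the gap**: `E(f) ≥ (c₁/32) ∑ f²` for `∑ f = 0` (`c₁ = 2 - 2cos(π/8) ≥ 3/20`);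
* `rayleigh_le`, `rayleigh_ge` — `-‖v‖² ≤ ⟨v, A v⟩ ≤ (1 - c₁/256) ‖v‖²`;
* **`spectralBound_lazy_graph`** — `λ(lazy G_m) ≤ 1 - c₁/512` (through `spectralBound_of_rayleigh`);
* `pw = 30720`, **`spectralBound_XG`** — `λ((lazy G_m)^{pw}) ≤ 1/10` (Bernoulli's inequality);
* the dense family for the Dinur round: `NM n = (⌊√n⌋+1)²`, `le_NM`, `NM_le : NM n ≤ 4n`, `XM n`,
  `spectralBound_XM`.

## References

* J. R. Lee, *On expanders from the action of GL(2,ℤ)*, arXiv:1301.6296 (2013), §2, Thm. 2.3.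
* O. Gabber, Z. Galil, *Explicit constructions of linear-sized superconcentrators*, JCSS 22 (1981), Thm. 1'.
* S. Hoory, N. Linial, A. Wigderson, *Expander graphs and their applications*, Bull. AMS 43 (2006), Thm. 8.1.
-/

noncomputable section

namespace Literature.Computability.Complexity

open Finset Matrix

namespace GabberGalil

open Expander Expander.RotGraph

variable (m : ℕ) [NeZero m]

/-! ### The graph -/

/-- Vertices as points of the discrete torus. [folklore] -/
def vert : Fin (m * m) ≃ ZMod m × ZMod m :=
  finProdFinEquiv.symm.trans (Equiv.prodCongr (ZMod.finEquiv m).toEquiv (ZMod.finEquiv m).toEquiv)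

/-- The eight neighbour maps: `x+1, x-1, y+1, y-1, (x+y,y), (x-y,y), (x,y+x), (x,y-x)`. [cite: Lee2013GL2Z, §2 (definition of G_n)] -/
def mv (i : Fin 8) (z : ZMod m × ZMod m) : ZMod m × ZMod m :=
  if i = 0 then (z.1 + 1, z.2) else if i = 1 then (z.1 - 1, z.2) else if i = 2 then (z.1, z.2 + 1) else if i = 3 then (z.1, z.2 - 1)
  else if i = 4 then uT z else if i = 5 then dT z else if i = 6 then uS z else dS z

/-- The inverse label: `0 ↔ 1`, `2 ↔ 3`, `4 ↔ 5`, `6 ↔ 7`. [folklore] -/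
def il (i : Fin 8) : Fin 8 := ![1, 0, 3, 2, 5, 4, 7, 6] i

/-- `il` is an involution. [folklore] -/
theorem il_il (i : Fin 8) : il (il i) = i := by fin_cases i <;> rfl

omit [NeZero m] in
/-- Following a label and then its inverse label returns. [folklore] -/
theorem mv_il_mv (i : Fin 8) (z : ZMod m × ZMod m) : mv m (il i) (mv m i z) = z := by
  fin_cases i <;> simp [mv, il, uS, uT, dS, dT]

/-- The rotation map of the Gabber–Galil graph. [cite: Lee2013GL2Z, §2] -/
def ggRot (x : Fin (m * m) × Fin 8) : Fin (m * m) × Fin 8 := ((vert m).symm (mv m x.2 (vert m x.1)), il x.2)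

/-- **The Gabber–Galil graph `G_m`** on `(ℤ/m)²`, `8`-regular. [cite: Lee2013GL2Z, §2] -/
def graph : RotGraph (m * m) 8 where
  rot := ggRot m
  rot_rot x := by
    unfold ggRot
    simp only [Equiv.apply_symm_apply, mv_il_mv, il_il, Equiv.symm_apply_apply, Prod.mk.eta]

/-- Neighbours of the graph, on the torus. [folklore] -/
theorem vert_nbr (u : Fin (m * m)) (i : Fin 8) : vert m ((graph m).nbr u i) = mv m i (vert m u) := by
  show vert m (ggRot m (u, i)).1 = _
  unfold ggRot; simp

/-! ### The energy and the Rayleigh quotient -/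

/-- The sum over the eight neighbours is twice the four-term energy plus bookkeeping:
`∑_z ∑_i (f z - f(mv i z))² = 2 E(f)`. [cite: Lee2013GL2Z, §2] -/
theorem sum_sum_sq_sub_eq (f : ZMod m × ZMod m → ℝ) :
    ∑ z, ∑ i : Fin 8, (f z - f (mv m i z)) ^ 2 = 2 * energyT f := by
  -- the odd labels are the inverses of the even ones
  have hinv : ∀ (e : ZMod m × ZMod m ≃ ZMod m × ZMod m), ∑ z, (f z - f (e.symm z)) ^ 2 = ∑ z, (f (e z) - f z) ^ 2 := fun e => by
    exact Fintype.sum_equiv e.symm _ _ fun z => by simp only [Equiv.apply_symm_apply]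
  let e0 : ZMod m × ZMod m ≃ ZMod m × ZMod m := ⟨fun z => (z.1 + 1, z.2), fun z => (z.1 - 1, z.2), fun z => by simp, fun z => by simp⟩
  let e2 : ZMod m × ZMod m ≃ ZMod m × ZMod m := ⟨fun z => (z.1, z.2 + 1), fun z => (z.1, z.2 - 1), fun z => by simp, fun z => by simp⟩
  let e4 : ZMod m × ZMod m ≃ ZMod m × ZMod m := ⟨uT, dT, dT_uT, uT_dT⟩
  let e6 : ZMod m × ZMod m ≃ ZMod m × ZMod m := ⟨uS, dS, dS_uS, uS_dS⟩
  have h1 := hinv e0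
  have h3 := hinv e2
  have h5 := hinv e4
  have h7 := hinv e6
  simp only [e0, e2, e4, e6, Equiv.coe_fn_symm_mk, Equiv.coe_fn_mk] at h1 h3 h5 h7
  simp only [Fin.sum_univ_eight, mv, Fin.isValue, if_true, show (1 : Fin 8) ≠ 0 by decide, show (2 : Fin 8) ≠ 0 by decide,
    show (2 : Fin 8) ≠ 1 by decide, show (3 : Fin 8) ≠ 0 by decide, show (3 : Fin 8) ≠ 1 by decide, show (3 : Fin 8) ≠ 2 by decide,
    show (4 : Fin 8) ≠ 0 by decide, show (4 : Fin 8) ≠ 1 by decide, show (4 : Fin 8) ≠ 2 by decide, show (4 : Fin 8) ≠ 3 by decide,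
    show (5 : Fin 8) ≠ 0 by decide, show (5 : Fin 8) ≠ 1 by decide, show (5 : Fin 8) ≠ 2 by decide, show (5 : Fin 8) ≠ 3 by decide,
    show (5 : Fin 8) ≠ 4 by decide, show (6 : Fin 8) ≠ 0 by decide, show (6 : Fin 8) ≠ 1 by decide, show (6 : Fin 8) ≠ 2 by decide,
    show (6 : Fin 8) ≠ 3 by decide, show (6 : Fin 8) ≠ 4 by decide, show (6 : Fin 8) ≠ 5 by decide, show (7 : Fin 8) ≠ 0 by decide,
    show (7 : Fin 8) ≠ 1 by decide, show (7 : Fin 8) ≠ 2 by decide, show (7 : Fin 8) ≠ 3 by decide, show (7 : Fin 8) ≠ 4 by decide,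
    show (7 : Fin 8) ≠ 5 by decide, show (7 : Fin 8) ≠ 6 by decide, if_false, sum_add_distrib]
  rw [h1, h3, h5, h7, energyT]
  simp only [← sum_add_distrib]
  rw [mul_sum]
  refine sum_congr rfl fun z _ => ?_
  simp only [uT, uS, add_comm z.2 z.1]
  ring

/-- The Rayleigh quotient of the walk matrix in terms of the energy: `⟨v, A v⟩ = ‖v‖² - E(f)/8` with
`f = v ∘ vert⁻¹`. [cite: Lee2013GL2Z, §2 (λ₂ as a Rayleigh quotient)] -/
theorem rayleigh_eq (v : Fin (m * m) → ℝ) :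
    v ⬝ᵥ ((graph m).walkMatrix *ᵥ v) = v ⬝ᵥ v - energyT (fun z => v ((vert m).symm z)) / 8 := by
  set f : ZMod m × ZMod m → ℝ := fun z => v ((vert m).symm z) with hf
  -- `⟨v, A v⟩ = (1/8) ∑_z f z ∑_i f (mv i z)`
  have hS : v ⬝ᵥ ((graph m).walkMatrix *ᵥ v) = (∑ z, ∑ i : Fin 8, f z * f (mv m i z)) / 8 := by
    simp only [dotProduct, walkMatrix_mulVec, Nat.cast_ofNat]
    rw [sum_div]
    refine Fintype.sum_equiv (vert m) _ _ fun u => ?_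
    have hn : ∀ i, f (mv m i (vert m u)) = v ((graph m).nbr u i) := fun i => by
      rw [hf]; simp only; rw [← vert_nbr, Equiv.symm_apply_apply]
    have hu : f (vert m u) = v u := by rw [hf]; simp
    simp only [hn, hu, ← mul_sum]
    ring
  have hvv : v ⬝ᵥ v = ∑ z, f z ^ 2 := by
    simp only [dotProduct, hf, ← sq]
    exact (Fintype.sum_equiv (vert m) _ _ fun u => by simp).trans rfl |>.symm.symm
  -- `∑∑ (f z - f(mv i z))² = 8 ∑ f² - 2 ∑∑ f z f (mv i z) + 8 ∑ f²`
  have hbij : ∀ i : Fin 8, ∑ z, f (mv m i z) ^ 2 = ∑ z, f z ^ 2 := fun i => by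
    refine Fintype.sum_equiv ⟨mv m i, mv m (il i), mv_il_mv m i, fun z => ?_⟩ _ _ fun z => rfl
    have := mv_il_mv m (il i) z; rwa [il_il] at this
  have hexp : ∑ z, ∑ i : Fin 8, (f z - f (mv m i z)) ^ 2 = 16 * ∑ z, f z ^ 2 - 2 * ∑ z, ∑ i : Fin 8, f z * f (mv m i z) := by
    have : ∀ z (i : Fin 8), (f z - f (mv m i z)) ^ 2 = f z ^ 2 + f (mv m i z) ^ 2 - 2 * (f z * f (mv m i z)) := fun z i => by ring
    simp only [this, sum_add_distrib, sum_sub_distrib, ← mul_sum]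
    rw [sum_comm (f := fun z i => f (mv m i z) ^ 2)]
    simp only [hbij, sum_const, card_univ, Fintype.card_fin, nsmul_eq_mul]
    push_cast
    simp only [← mul_sum]
    ring
  rw [sum_sum_sq_sub_eq] at hexp
  rw [hS, hvv]
  linarith

/-- **The spectral gap of the Gabber–Galil graph** (discrete Gabber–Galil/Lee): `E(f) ≥ (c₁/32) ∑ f²` for
`∑ f = 0`. [cite: Lee2013GL2Z, Thm. 2.3] -/
theorem energyT_ge (f : ZMod m × ZMod m → ℝ) (hf : ∑ z, f z = 0) : c₁ / 32 * ∑ z, f z ^ 2 ≤ energyT f := by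
  have hmpos : (0 : ℝ) < m := by exact_mod_cast Nat.pos_of_ne_zero (NeZero.ne m)
  have h1 := sum_sq_le_mul_energyF (modulus f) (modulus_nonneg f) (by rw [show (0 : ZMod m × ZMod m) = ((0 : ZMod m), (0 : ZMod m)) from rfl, modulus_zero, hf, abs_zero])
  rw [sum_modulus_sq] at h1
  have h2 := energyF_modulus_le f
  have hc := c₁_pos
  -- `m² ∑ f² ≤ (32/c₁) m² E(f)`
  have h3 : (m : ℝ) ^ 2 * ∑ z, f z ^ 2 ≤ 32 / c₁ * ((m : ℝ) ^ 2 * energyT f) := h1.trans (mul_le_mul_of_nonneg_left h2 (by positivity))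
  have hm2 : (0 : ℝ) < (m : ℝ) ^ 2 := by positivity
  rw [div_mul_eq_mul_div, le_div_iff₀ hc] at h3
  have h4 : (∑ z, f z ^ 2) * c₁ ≤ 32 * energyT f := by
    refine le_of_mul_le_mul_left (a := (m : ℝ) ^ 2) ?_ hm2
    calc (m : ℝ) ^ 2 * ((∑ z, f z ^ 2) * c₁) = ((m : ℝ) ^ 2 * ∑ z, f z ^ 2) * c₁ := by ring
      _ ≤ 32 * ((m : ℝ) ^ 2 * energyT f) := h3
      _ = (m : ℝ) ^ 2 * (32 * energyT f) := by ring
  calc c₁ / 32 * ∑ z, f z ^ 2 = ((∑ z, f z ^ 2) * c₁) / 32 := by ring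
    _ ≤ (32 * energyT f) / 32 := by gcongr
    _ = energyT f := by ring

/-- **Upper Rayleigh bound**: `⟨v, A v⟩ ≤ (1 - c₁/256) ‖v‖²` for `v ⊥ 1`. [cite: Lee2013GL2Z, Thm. 2.3] -/
theorem rayleigh_le (v : Fin (m * m) → ℝ) (hv : ∑ u, v u = 0) :
    v ⬝ᵥ ((graph m).walkMatrix *ᵥ v) ≤ (1 - c₁ / 256) * (v ⬝ᵥ v) := by
  rw [rayleigh_eq]
  set f : ZMod m × ZMod m → ℝ := fun z => v ((vert m).symm z)
  have hf : ∑ z, f z = 0 := by rw [← hv]; exact Fintype.sum_equiv (vert m).symm _ _ fun z => rfl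
  have hvv : v ⬝ᵥ v = ∑ z, f z ^ 2 := by
    simp only [dotProduct, ← sq]
    exact (Fintype.sum_equiv (vert m).symm _ _ fun z => rfl).symm
  have h := energyT_ge m f hf
  rw [hvv]
  linarith

/-- **Lower Rayleigh bound**: `-‖v‖² ≤ ⟨v, A v⟩` (contraction and Cauchy–Schwarz). [folklore] -/
theorem rayleigh_ge (v : Fin (m * m) → ℝ) : -(v ⬝ᵥ v) ≤ v ⬝ᵥ ((graph m).walkMatrix *ᵥ v) := by
  have hcs : (v ⬝ᵥ ((graph m).walkMatrix *ᵥ v)) ^ 2 ≤ (v ⬝ᵥ v) * (((graph m).walkMatrix *ᵥ v) ⬝ᵥ ((graph m).walkMatrix *ᵥ v)) := by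
    have h := sum_mul_sq_le_sq_mul_sq (univ : Finset (Fin (m * m))) v ((graph m).walkMatrix *ᵥ v)
    simpa [dotProduct, sq] using h
  have hcontr : ((graph m).walkMatrix *ᵥ v) ⬝ᵥ ((graph m).walkMatrix *ᵥ v) ≤ v ⬝ᵥ v := by
    have h := (graph m).normSq_avg_nbr_le (by norm_num) v
    simp only [dotProduct, walkMatrix_mulVec, ← sq]
    simpa [sq] using h
  have hvv : 0 ≤ v ⬝ᵥ v := by simp only [dotProduct]; exact sum_nonneg fun i _ => mul_self_nonneg _
  have : (v ⬝ᵥ ((graph m).walkMatrix *ᵥ v)) ^ 2 ≤ (v ⬝ᵥ v) ^ 2 := hcs.trans (by rw [sq]; exact mul_le_mul_of_nonneg_left hcontr hvv)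
  nlinarith [abs_le_of_sq_le_sq' this hvv]

/-- **`λ(lazy G_m) ≤ 1 - c₁/512`.** [cite: Lee2013GL2Z, Thm. 2.3] -/
theorem spectralBound_lazy_graph : SpectralBound (graph m).lazy.walkMatrix (1 - c₁ / 512) := by
  have hc := c₁_pos
  have hc4 := c₁_le
  refine spectralBound_of_rayleigh ((graph m).lazy.isWalkMatrix_walkMatrix (by norm_num)) (by linarith) fun v hv => ?_
  rw [(graph m).walkMatrix_lazy (by norm_num)]
  have hL : v ⬝ᵥ (((1 / 2 : ℝ) • (1 + (graph m).walkMatrix)) *ᵥ v) = (v ⬝ᵥ v + v ⬝ᵥ ((graph m).walkMatrix *ᵥ v)) / 2 := by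
    rw [smul_mulVec, add_mulVec, one_mulVec, dotProduct_smul, dotProduct_add, smul_eq_mul]; ring
  rw [hL]
  have h1 := rayleigh_le m v hv
  have h2 := rayleigh_ge m v
  have hvv : 0 ≤ v ⬝ᵥ v := by simp only [dotProduct]; exact sum_nonneg fun i _ => mul_self_nonneg _
  rw [abs_le]
  constructor <;> nlinarith

/-! ### Powering down to `1/10` -/

/-- The power used: `pw = 30720` (so that `pw · c₁/512 ≥ 9`). [folklore] -/
def pw : ℕ := 30720

/-- Bernoulli: `(1 - x)^p ≤ 1/(1 + p x)` for `0 ≤ x ≤ 1`. [folklore] -/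
theorem one_sub_pow_le {x : ℝ} (hx0 : 0 ≤ x) (hx1 : x ≤ 1) (p : ℕ) : (1 - x) ^ p ≤ 1 / (1 + p * x) := by
  have hb : 1 + (p : ℝ) * x ≤ (1 + x) ^ p := one_add_mul_le_pow (by linarith) p
  have hpos : 0 < 1 + (p : ℝ) * x := by positivity
  rw [le_div_iff₀ hpos]
  calc (1 - x) ^ p * (1 + p * x) ≤ (1 - x) ^ p * (1 + x) ^ p := mul_le_mul_of_nonneg_left hb (pow_nonneg (by linarith) _)
    _ = (1 - x ^ 2) ^ p := by rw [← mul_pow]; congr 1; ring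
    _ ≤ 1 := pow_le_one₀ (by nlinarith) (by nlinarith)

/-- **`λ((lazy G_m)^{pw}) ≤ 1/10`.** [cite: Lee2013GL2Z, Thm. 2.3 (amplified by powering)] -/
theorem spectralBound_XG : SpectralBound ((graph m).lazy.power pw).walkMatrix (1 / 10) := by
  have h := spectralBound_power (graph m).lazy (by norm_num) (spectralBound_lazy_graph m) pw
  have hc := c₁_ge
  have hc4 := c₁_le
  have hx0 : (0 : ℝ) ≤ c₁ / 512 := by linarith
  have hx1 : c₁ / 512 ≤ 1 := by linarith
  have hle : (1 - c₁ / 512) ^ pw ≤ 1 / 10 :=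
    calc (1 - c₁ / 512) ^ pw ≤ 1 / (1 + (pw : ℝ) * (c₁ / 512)) := one_sub_pow_le hx0 hx1 pw
      _ ≤ 1 / 10 := by
          rw [pw]; push_cast
          rw [div_le_div_iff₀ (by positivity) (by norm_num)]
          nlinarith
  have h0 : 0 ≤ (1 - c₁ / 512) ^ pw := pow_nonneg (by linarith) _
  refine ⟨by norm_num, fun v hv => (h.2 v hv).trans ?_⟩
  have hvv : 0 ≤ v ⬝ᵥ v := by simp only [dotProduct]; exact sum_nonneg fun i _ => mul_self_nonneg _
  exact mul_le_mul_of_nonneg_right (by nlinarith) hvv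

/-! ### The dense family -/

/-- The degree `dM = 16^{pw}` of the powered lazy graphs. [folklore] -/
def dM : ℕ := (8 + 8) ^ pw

/-- `dM > 0`. [folklore] -/
theorem dM_pos : 0 < dM := by unfold dM; positivity

/-- The side length `⌊√n⌋ + 1`. [folklore] -/
def side (n : ℕ) : ℕ := Nat.sqrt n + 1

/-- `side n ≠ 0`. [folklore] -/
instance (n : ℕ) : NeZero (side n) := ⟨Nat.succ_ne_zero _⟩

/-- **The padded size** `NM n = (⌊√n⌋ + 1)²`. [folklore] -/
def NM (n : ℕ) : ℕ := side n * side n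

/-- `n ≤ NM n`. [folklore] -/
theorem le_NM (n : ℕ) : n ≤ NM n := (Nat.lt_succ_sqrt n).le

/-- `NM n ≤ 4 n` for `n ≥ 1`. [folklore] -/
theorem NM_le {n : ℕ} (hn : 0 < n) : NM n ≤ 4 * n := by
  unfold NM side
  have hs : 1 ≤ Nat.sqrt n := Nat.le_sqrt.2 (by omega)
  have hsq : Nat.sqrt n * Nat.sqrt n ≤ n := Nat.sqrt_le n
  nlinarith

/-- **The expanders used to expanderize**: `XM n = (lazy G_{side n})^{pw}` on `NM n` vertices. [cite: Lee2013GL2Z, Thm. 2.3] -/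
def XM (n : ℕ) : RotGraph (NM n) dM := (graph (side n)).lazy.power pw

/-- `λ(XM n) ≤ 1/10`. [cite: Lee2013GL2Z, Thm. 2.3] -/
theorem spectralBound_XM (n : ℕ) : SpectralBound (XM n).walkMatrix (1 / 10) := spectralBound_XG (side n)

end GabberGalil

end Literature.Computability.Complexity

end
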